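import Summits.BirchSwinnertonDyer.BirchSwinnertonDyer.Theorems.ErratumRoadFiveNonSurjCornerMuTransferMultContra
import Summits.BirchSwinnertonDyer.BirchSwinnertonDyer.Theorems.ErratumRoadFiveNonSurjCornerBranchesAn
import Summits.BirchSwinnertonDyer.BirchSwinnertonDyer.Theorems.ByReductionTypeAtTwoKatoContraRekey
import Literature.NumberTheory.EllipticCurves.ManinConstantClassCertificate
import HarnessLib

/-!
# Route `ErratumRoadFive` (rung K2), crux `NonSurjCorner` (item stmt-BirchSwinnertonDyer-19065), the twin summand: THE KATO HALF AT A MULTIPLICATIVE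
# ODD PRIME WITHOUT BIG IMAGE, RE-KEYED ON THE PRINT-EXACT CONTRAGREDIENT PACKAGES V′ ∕ VI′ ∕ XI′ — the ER5 ∕ x11a chain theorems
# `X11b.multDivisibilityAt_of_katoFacts_of_muAn[ZeroAt]` with their three Kato §17.13 construction facts swapped for the twins (ARM-P R-48 END re-key)
# (cell `bsd-stepL`, seat `bsd-stepL-corner-p1` g16; `--supports stmt-BirchSwinnertonDyer-19065 --as helper`)

WHY THIS FILE. The twin road of crux 19065 (and x11a's K2 chain, 163 cell theorems — bsd-print-x11a REF g16) reads Kato's `⊗ℚ` divisibility at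
`p ∥ N` through THREE §17.13 ∃-package facts of item 19949 `KatoTwinFactsFiveAn`: V `Kato2004.exists_multDivisibilityInputs_nonsplit`, VI `…_split`
(via bsd-2adic's `MultKatoRat.katoMultiplicativeDivisibilityRat_of_facts_odd` inside this seat g6's `X11b.multDivisibilityAt_of_katoFacts_of_muAn`)
and XI `…_fine` (the μ-road, this seat's `MultMu.mu_eq_zero_of_multFine`). ARM-P's audit (r02 ADDENDUM-8, bsd-cited RULING (650); RELAYS 47–49–52
to this cell) classified all three, AS TYPED, STRONGER-THAN-PRINT-BY-ι (γ-keyed dual); the print-exact contragredient twins V′ ∕ VI′ ∕ XI′ landed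
as p604443, the plain-Selmer twist T-TWIST-SEL-1 as p609264, the covariant↔contragredient bridges with the multiplicative functional equation BY
NAME as p610934, bsd-2adic's END re-key VII′ `SelmerDualContra.katoDivisibility_{nonsplit,split}Mult_of_contra_facts[_conductorLevel]` as p613557,
and this seat's μ-road re-key `MultMu.mu_eq_zero_of_multFineContra` as p613107. THIS FILE composes them into the CONSUMER re-key of the chain:
* §1 `X11b.katoMultiplicativeDivisibilityRat_of_contraFacts_odd` — bsd-2adic's research binder `X5.O1.KatoMultiplicativeDivisibilityRat W p`
  (Kato's `⊗ℚ` divisibility at `p ∥ N`, both signs, no image hypothesis) at every ODD multiplicative prime from {`nonempty_iwasawaH1Data`,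
  `thm12_4`, V′, VI′, `Greenberg1999.thm15_isTorsion_multiplicative_rat`, modularity `exists_isNewformOf` (only to identify the newform's level
  with the conductor, `IsNewformOf.level_eq_conductorNorm_of_exists_isNewformOf` — the functional equation inside VII′ is read at level `N_W = p·M`)}.
* §2 **`X11b.multDivisibilityAt_of_katoFacts_of_muAn_contra`** and **`X11b.multDivisibilityAt_of_katoFacts_of_muAnZeroAt_contra`** — the chain
  theorems of record (`…BranchesAn` :87, `…TwinMuOfLane` :220) VERBATIM with `hns ∕ hsp ∕ hfine ↦ hns′ ∕ hsp′ ∕ hfine′` (+ `hnf`); conclusion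
  `X11b.MultDivisibilityAt W p` UNCHANGED, so every downstream door re-keys by swapping three hypothesis constants (x11a's ask, INBOX 04:40:30Z).
* §3 `X11b.multDivisibilityAt_of_katoFacts_of_corollary18_of_mu_eq_zero_contra` — the `μ = 0`-keyed form (`…TwinKatoFacts` :79) likewise.

HONEST FRAMING: THEOREMS ONLY (no definition, no named fact, no `sorry`); CONDITIONAL on the displayed named facts (V′ ∕ VI′ ∕ XI′ are CONSTRUCTION
facts, flag `Kato-1713-dual-action`, print-exact per ARM-P; Kato 12.4, (12.2.1), Greenberg Thm 1.5, Wuthrich Cor. 18, modularity); item 19949 keeps its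
text (a repaired support item `KatoTwinFactsFiveAnContra` is the planner's call); nothing about any curve; items 19065 ∕ 19948 ∕ 19949 do not close;
BSD is not advanced; T7. Credit: bsd-2adic tower-1 g19 (T-TWIST-SEL-1, bridges, VII′), defn-ty1 g18 (twins), bsd-wall (involution API), b2b (ι-fixed
primes), ARM-P r02 ∕ lead.
References (locators only): [cite: Kato2004Asterisque, Thm. 12.4–12.6 (pp. 221–222), Thm. 17.4 (p. 273), §17.13 (pp. 279–280)]
[cite: MazurTateTeitelbaum1986Invent, §I.17] [cite: Greenberg1989, §0 pp. 101–102 (S^ι)] [cite: Wuthrich2014, p. 391, Cor. 18–19 (p. 398)]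
[cite: GreenbergLNM1716, Thm. 1.5 (PDF p. 61)] [cite: DiamondShurman2005, Thm. 8.8.1 (level = conductor)].
-/

set_option autoImplicit false
set_option linter.dupNamespace false

noncomputable section

open scoped Classical NumberField MatrixGroups ModularForm
open CongruenceSubgroup WeierstrassCurve NumberField IsDedekindDomain Field
open Literature.NumberTheory.GaloisRepresentations
open Literature.NumberTheory.GaloisCohomology
open Literature.NumberTheory.EllipticCurves Literature.NumberTheory.EllipticCurves.ModularForms
open Literature.NumberTheory.EllipticCurves.Kato2004
open Literature.NumberTheory.EllipticCurves.Rank1Residual Literature.NumberTheory.EllipticCurves.Rank1Residual.Typed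
open Literature.NumberTheory.EllipticCurves.Wuthrich2014 Literature.NumberTheory.EllipticCurves.Greenberg1999
open Summit.BirchSwinnertonDyer.Rank1Residual Summit.BirchSwinnertonDyer.Rank1Residual.X5.O1
open Summit.BirchSwinnertonDyer.BirchSwinnertonDyer.Theorems

namespace Summit.BirchSwinnertonDyer.Rank1Residual.X11b

/-! ### §1 Kato's `⊗ℚ` divisibility at an odd multiplicative prime from the CONTRAGREDIENT packages V′ ∕ VI′ -/

/-- **`X5.O1.KatoMultiplicativeDivisibilityRat W p` at an ODD multiplicative prime from the PRINT-EXACT contragredient §17.13 packages** —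
bsd-2adic's `MultKatoRat.katoMultiplicativeDivisibilityRat_of_facts_odd` with V ∕ VI ↦ V′ ∕ VI′: for each sign the END theorem of bsd-2adic's
contra re-key (`SelmerDualContra.katoDivisibility_{nonsplit,split}Mult_of_contra_facts_conductorLevel`: twist `D ↦ D′`, Kato's module theory on the
contragredient package, back by the multiplicative functional equation BY NAME), at the conductor level (the newform's level IS the conductor:
`IsNewformOf.level_eq_conductorNorm_of_exists_isNewformOf`, modularity `hnf`); the zero function is the trivial case. CONDITIONAL on the named facts;
nothing booked. [cite: Kato2004Asterisque, Thm. 17.4 (1)(2) (p. 273; shape), §17.13 (pp. 279–280)] [cite: MazurTateTeitelbaum1986Invent, §I.17]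
[cite: GreenbergLNM1716, Thm. 1.5 (PDF p. 61)] [cite: DiamondShurman2005, Thm. 8.8.1] -/
theorem katoMultiplicativeDivisibilityRat_of_contraFacts_odd
    (W : WeierstrassCurve ℚ) [W.IsElliptic] [W.IsGloballyMinimal] (p : ℕ) [Fact p.Prime] (hp : p ≠ 2)
    (hne : nonempty_iwasawaH1Data) (h12 : thm12_4) (hnf : exists_isNewformOf)
    (hns' : exists_multDivisibilityInputs_nonsplit_contra) (hsp' : exists_multDivisibilityInputs_split_contra)
    (h15 : thm15_isTorsion_multiplicative_rat) : KatoMultiplicativeDivisibilityRat W p := by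
  haveI : ContinuousSMul ℤ_[p] (W.tateModule p) := TateModule.continuousSMul_padicInt
  intro κ γ hκ hγ hγ' hmult N _ f hf D
  have hN : N = W.conductorNorm ℤ := IsNewformOf.level_eq_conductorNorm_of_exists_isNewformOf hnf hf
  subst hN
  refine ⟨h15 W p hmult f hf κ γ hκ hγ D, fun hnsp L hL => ?_, fun hspl L hL => ?_⟩
  · by_cases hL0 : L = 0
    · exact ⟨0, 0, Submodule.zero_mem _, by simp [hL0]⟩
    · obtain ⟨-, n, g, hg, hι⟩ := SelmerDualContra.katoDivisibility_nonsplitMult_of_contra_facts_conductorLevel hne h12 hns' hp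
        hmult hnsp hκ hγ hγ' hf hL hL0 D
      exact ⟨n, g, hg, hι⟩
  · by_cases hL0 : L = 0
    · exact ⟨0, 0, Submodule.zero_mem _, by simp [hL0]⟩
    · obtain ⟨-, n, g, hg, hι⟩ := SelmerDualContra.katoDivisibility_splitMult_of_contra_facts_conductorLevel hne h12 hsp' hp
        hspl hκ hγ hγ' hf hL hL0 D
      exact ⟨n, g, hg, hι⟩

/-! ### §2 The chain theorems of record, re-keyed (conclusion `X11b.MultDivisibilityAt W p` unchanged) -/

/-- **`X11b.MultDivisibilityAt W p` from the analytic `μ = 0` certificate, on the contragredient packages** — `multDivisibilityAt_of_katoFacts_of_muAn`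
(`…BranchesAn`) VERBATIM with `hns ∕ hsp ∕ hfine ↦ hns′ ∕ hsp′ ∕ hfine′` (and modularity `hnf` for the level): for `W` globally minimal, `p` an ODD
multiplicative prime with `E[p]` irreducible and `ρ̄_{E,p}` NOT onto, the unit-coefficient certificate `hAn` at every newform ∕ period ratio ∕ MTT
function gives the typed divisibility — `μ = 0` by `MultMu.mu_eq_zero_of_multFineContra` (XI′), `⊗ℚ` divisibility by §1 (V′ ∕ VI′), integrality by
Wuthrich Cor. 18, membership by `mem_charIdeal_of_katoRat_of_integral_of_mu_eq_zero` ∕ `…_split`. CONDITIONAL on the named facts; nothing booked.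
[cite: Kato2004Asterisque, Thm. 12.4 (p. 221), Thm. 12.6 (p. 222) and §17.13 (pp. 279–280)] [cite: Wuthrich2014, Cor. 18 (p. 398)]
[cite: GreenbergLNM1716, Thm. 1.5 (p. 61)] -/
theorem multDivisibilityAt_of_katoFacts_of_muAn_contra
    (hne : nonempty_iwasawaH1Data) (h12 : thm12_4) (hnf : exists_isNewformOf)
    (hns' : exists_multDivisibilityInputs_nonsplit_contra)
    (hsp' : exists_multDivisibilityInputs_split_contra)
    (h15 : thm15_isTorsion_multiplicative_rat)
    (h18 : corollary18_padicLFunction_mem_iwasawaAlgebra_multiplicative)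
    (hfine' : exists_multDivisibilityInputs_fine_contra)
    (W : WeierstrassCurve ℚ) [W.IsElliptic] [W.IsGloballyMinimal] (p : ℕ) [Fact p.Prime]
    (hp : p ≠ 2) (hmult : Mult W p) (hirr : Irr W p) (hnsurj : ¬ Surj W p)
    (hAn : ∀ {N : ℕ} [NeZero N] (f : CuspForm (Gamma0 N) 2), IsNewformOf W f →
      ∀ (ϖ : ℚ), (ϖ : ℝ) * W.realPeriodRat = plusPeriod f →
      ∀ (a : ℚ_[p]) (L : PowerSeries ℚ_[p]),
        (W.HasSplitMultiplicativeReductionAtPrime p → a = 1) →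
        (¬ W.HasSplitMultiplicativeReductionAtPrime p → a = -1) →
        IsMultPAdicLFunctionOf f p a L →
        ∃ n : ℕ, ‖PowerSeries.coeff n (PowerSeries.C ((ϖ : ℚ) : ℚ_[p]) * L)‖ = 1) :
    MultDivisibilityAt W p := by
  have hK : KatoMultiplicativeDivisibilityRat W p :=
    katoMultiplicativeDivisibilityRat_of_contraFacts_odd W p hp hne h12 hnf hns' hsp' h15
  intro κ γ N _ f hκ hγ hγ' hf D ϖ _hϖ0 hϖ
  obtain ⟨hX, hnsK, hsK⟩ := hK κ γ hκ hγ hγ' hmult f hf D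
  obtain ⟨hint_ns, hint_s⟩ := h18 W p hp hmult hf ϖ hϖ
  refine ⟨hX, fun hn L hL => ?_, fun hsplit L hL => ?_⟩
  · have hμD : D.mu = 0 :=
      MultMu.mu_eq_zero_of_multFineContra hfine' h18 W p f hp hmult hirr hnsurj hf ϖ hϖ (-1) L
        (fun hs => absurd hs hn) (fun _ => rfl) hL
        (hAn f hf ϖ hϖ (-1) L (fun hs => absurd hs hn) (fun _ => rfl) hL) κ γ hκ hγ hγ' D
    obtain ⟨n, g, hg, hι⟩ := hnsK hn L hL
    obtain ⟨G, hG⟩ := hint_ns hn L hL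
    exact ⟨G, mem_charIdeal_of_katoRat_of_integral_of_mu_eq_zero hγ D hX hμD hg hι hG, hG⟩
  · have hL1 : IsMultPAdicLFunctionOf f p 1 L := (isMultPAdicLFunctionOf_one_iff L).mpr hL
    have hμD : D.mu = 0 :=
      MultMu.mu_eq_zero_of_multFineContra hfine' h18 W p f hp hmult hirr hnsurj hf ϖ hϖ 1 L
        (fun _ => rfl) (fun hns'' => absurd hsplit hns'') hL1
        (hAn f hf ϖ hϖ 1 L (fun _ => rfl) (fun hns'' => absurd hsplit hns'') hL1) κ γ hκ hγ hγ' D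
    obtain ⟨n, g, hg, hι⟩ := hsK hsplit L hL
    obtain ⟨G, hG⟩ := hint_s hsplit L hL
    exact exists_mem_charIdeal_of_katoRat_of_integral_of_mu_eq_zero_split hγ D hX hμD hg hι hG

/-- **`X11a.MuAnZeroAt W p ⟹ X11b.MultDivisibilityAt W p` at an odd multiplicative pair with `E[p]` irreducible and `ρ̄` NOT onto, on the
contragredient packages** — `multDivisibilityAt_of_katoFacts_of_muAnZeroAt` (`…TwinMuOfLane` :220) VERBATIM with the three Kato facts swapped for
their twins (+ `hnf`): unpack the lane certificate into the `a = ±1` form and apply §2. This is the theorem x11a's K2 chain consumes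
(`Rank1Residual.X11b.multDivisibilityAt_of_katoFacts_of_muAnZeroAt`); its conclusion and name-shape are unchanged. CONDITIONAL; nothing booked.
[cite: Kato2004Asterisque, Thm. 12.4 (p. 221), Thm. 12.6 (p. 222) and §17.13 (pp. 279–280)] [cite: Wuthrich2014, Cor. 18 (p. 398)]
[cite: GreenbergLNM1716, Thm. 1.5 (p. 61)] -/
theorem multDivisibilityAt_of_katoFacts_of_muAnZeroAt_contra
    (hne : nonempty_iwasawaH1Data) (h12 : thm12_4) (hnf : exists_isNewformOf)
    (hns' : exists_multDivisibilityInputs_nonsplit_contra)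
    (hsp' : exists_multDivisibilityInputs_split_contra)
    (h15 : thm15_isTorsion_multiplicative_rat)
    (h18 : corollary18_padicLFunction_mem_iwasawaAlgebra_multiplicative)
    (hfine' : exists_multDivisibilityInputs_fine_contra)
    (W : WeierstrassCurve ℚ) [W.IsElliptic] [W.IsGloballyMinimal] (p : ℕ) [Fact p.Prime]
    (hp : p ≠ 2) (hmult : Mult W p) (hirr : Irr W p) (hnsurj : ¬ Surj W p) (hA : X11a.MuAnZeroAt W p) :
    MultDivisibilityAt W p :=
  multDivisibilityAt_of_katoFacts_of_muAn_contra hne h12 hnf hns' hsp' h15 h18 hfine' W p hp hmult hirr hnsurj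
    (fun f hf ϖ hϖ a L hsa hna hL => by
      obtain ⟨hAns, hAs⟩ := hA f hf ϖ hϖ
      by_cases hsplit : W.HasSplitMultiplicativeReductionAtPrime p
      · have ha : a = 1 := hsa hsplit
        subst ha
        exact hAs hsplit L ((isMultPAdicLFunctionOf_one_iff L).mp hL)
      · have ha : a = -1 := hna hsplit
        subst ha
        exact hAns hsplit L hL)

/-! ### §3 The `μ = 0`-keyed form -/

/-- **`X11b.MultDivisibilityAt W p` at an odd multiplicative prime from the named facts and `μ = 0` (shape), on the contragredient packages** —
`multDivisibilityAt_of_katoFacts_of_corollary18_of_mu_eq_zero` (`…TwinKatoFacts` :79) with V ∕ VI ↦ V′ ∕ VI′ (+ `hnf`). NO image hypothesis.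
[cite: Kato2004Asterisque, Thm. 12.4 (p. 221), §17.13 (pp. 279–280)] [cite: Wuthrich2014, Cor. 18 (p. 398)] [cite: GreenbergLNM1716, Thm. 1.5] -/
theorem multDivisibilityAt_of_katoFacts_of_corollary18_of_mu_eq_zero_contra
    (hne : nonempty_iwasawaH1Data) (h12 : thm12_4) (hnf : exists_isNewformOf)
    (hns' : exists_multDivisibilityInputs_nonsplit_contra)
    (hsp' : exists_multDivisibilityInputs_split_contra)
    (h15 : thm15_isTorsion_multiplicative_rat)
    (h18 : corollary18_padicLFunction_mem_iwasawaAlgebra_multiplicative)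
    (W : WeierstrassCurve ℚ) [W.IsElliptic] [W.IsGloballyMinimal] (p : ℕ) [Fact p.Prime]
    (hp : p ≠ 2) (hmult : Mult W p)
    (hμ : ∀ (κ : ZpExtension ℚ p) (γ : Field.absoluteGaloisGroup ℚ),
      κ.IsCyclotomic → κ.IsTopGenerator γ → IsCyclotomicVariable p γ →
      ∀ D : W.SelmerDualData κ γ, D.mu = 0) :
    MultDivisibilityAt W p :=
  multDivisibilityAt_of_katoMultRat_of_corollary18_of_mu_eq_zero h18 W p hp hmult
    (katoMultiplicativeDivisibilityRat_of_contraFacts_odd W p hp hne h12 hnf hns' hsp' h15) hμ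

end Summit.BirchSwinnertonDyer.Rank1Residual.X11b

end
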